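import Mathlib
import Summits.ValiantsHypothesis.ValiantsHypothesis.Theorems.LacunarySymmetroidMatrixDescartesRegimeWindowsToolkit
import Summits.ValiantsHypothesis.ValiantsHypothesis.Theorems.LacunarySymmetroidMatrixDescartesPivotValleyCore

/-!
# `MatrixDescartes` (stmt-ValiantsHypothesis-18050) — the PIVOT-VALLEY LAW: a pencil with ONE free letter and PSD
# letters on both sides has `Z₊ ≤ 2·card ι` whenever its valley carries no zero (cross-pivot dominance at two scales)

HONEST FRAMING.  Cell `pub-symmetroid`, seat `val-sym-mdr-p2` (gen 5); helper file `--supports` the crux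
`Theses.LacunarySymmetroid.MatrixDescartes`.  A K-free SECTOR law with magnitude hypotheses for the two-sided
PSD-core words `X^{d_π} J + Σ_{l ≠ π} X^{d_l} P_l` (`J` ANY symmetric, `P_l ⪰ 0`, letters on both sides of the pivot,
any gaps, any number of letters) — the indefinite-pivot counterpart of gen 4's `dominantMiddle` / gen 5's
`signWord_posRoots_le`, which need a semidefinite pivot block.  Nothing here bears on the crux in its window, on
`stub_twoSided` in general (no hypothesis-free law is claimed: `not_wLaw_two`, `not_oneBelowLaw_two` have `3n` zeros
inside the valley), on `DoorA26` / `DoorA34`, or on `VP ≠ VNP`.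

THE LAW.  Normalise by the pivot monomial: `G(u) = F(u)/u^{d_π} = J + Σ_{d_l<d_π} u^{−(d_π−d_l)}P_l + Σ_{d_l>d_π}
u^{d_l−d_π}P_l` (the free letter `J` becomes CONSTANT — the only normalisation that tames it).  The letters below the
pivot give Loewner non-increasing terms, the letters above non-decreasing ones.  CROSS-PIVOT DOMINANCE (new scalar
lemmas `PivotValley.scalar_anti_left` / `scalar_mono_right`; the tree's `dominatedWindow_*` lemmas dominate far
blocks by an adjacent letter on the SAME side of the pivot and cannot express this):
* if at the scale `x₁` the below-letters' decrease dominates the above-letters' increase,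
  `Σ_{d_l<d_π} (d_π−d_l)·x₁^{d_l}·P_l ⪰ Σ_{d_l>d_π} (d_l−d_π)·x₁^{d_l}·P_l`, then `G` is Loewner non-increasing on
  `(0, x₁]` (`flank_anti_left`; termwise the ratio of the two sides only improves as `u` decreases);
* if at `x₂` the above-letters dominate, `Σ_{d_l>d_π} (d_l−d_π)·x₂^{d_l}·P_l ⪰ Σ_{d_l<d_π} (d_π−d_l)·x₂^{d_l}·P_l`,
  then `G` is Loewner non-decreasing on `[x₂, ∞)` (`flank_mono_right`).
Hence (tree toolkit `posRoots_Ioo_le_of_anti`, `posRoots_Ici_le_of_mono`) at most `card ι` zeros of `det F` in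
`(0, x₁)` and at most `card ι` in `[x₂, ∞)`; the two scales can coincide only in degenerate cases, and the VALLEY
`[x₁, x₂)` is where all the `> 2·card ι` witnesses of the tree live.  `pivotValley_posRoots_le`: if the valley carries
no zero, `Z₊ ≤ 2·card ι`; `pivotValley_posRoots_le_of_certificate`: the valley carries no zero whenever
`Σ_{l≠π} x₁^{d_l}·P_l ≻ x₂^{d_π}·J₋` for some `J₋ ⪰ 0` with `J + J₋ ⪰ 0` (on `[x₁,x₂]` every PSD term is at least its
value at `x₁` and `−x^{d_π}J₋ ⪰ −x₂^{d_π}J₋`, so `F(x) ≻ 0`).  At `x₁ = x₂` the certificate is implied by nothing and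
must be checked; with `x₁ < x₂` it is a genuine smallness condition on the negative part of `J` at the valley scale.
[folklore] Elementary; Mathlib + tree lemmas (`DominantMiddle.pow_sub_pow_window/_ge`, `coeff_above/below`,
`quadForm_diff`, `LoewnerSector.smul_family_isSymm`, `ChainSector.eval_det_pencil`, toolkit); axioms `propext`,
`Classical.choice`, `Quot.sound`.
-/

-- layout Summits/ValiantsHypothesis/ValiantsHypothesis forces the duplicated namespace component
set_option linter.dupNamespace false

namespace Summit.ValiantsHypothesis.ValiantsHypothesis.Theorems.LacunarySymmetroidMatrixDescartes

open Polynomial Matrix Finset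
open scoped BigOperators

/-- **Left flank.**  `F = ∑ₗ X^{dₗ} Sₗ`, pivot index `π` (its letter arbitrary), every letter off the pivot EXPONENT
positive semidefinite; if at `x₁ > 0` the below-pivot letters dominate the above-pivot ones in the derivative sense,
`∑_{d_l<d_π}(d_π−d_l)·x₁^{d_l}·S_l ⪰ ∑_{d_l>d_π}(d_l−d_π)·x₁^{d_l}·S_l`, then `u ↦ F(u)/u^{d_π}` is Loewner
non-increasing on `(0, x₁]`. [folklore] -/
theorem flank_anti_left {ι : Type} [Fintype ι] [DecidableEq ι] {K : ℕ} (d : Fin K → ℕ)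
    (S : Fin K → Matrix ι ι ℝ) (hS : ∀ l, (S l).IsSymm) (π : Fin K) (hsign : ∀ l, d l ≠ d π → (S l).PosSemidef)
    (x₁ : ℝ) (hx₁ : 0 < x₁)
    (hdom : (∑ l ∈ univ.filter (fun l => d l < d π), (((d π - d l : ℕ) : ℝ) * x₁ ^ d l) • S l
      - ∑ l ∈ univ.filter (fun l => d π < d l), (((d l - d π : ℕ) : ℝ) * x₁ ^ d l) • S l).PosSemidef)
    (s t : ℝ) (hs : 0 < s) (hst : s ≤ t) (htx : t ≤ x₁) :
    (((s ^ d π)⁻¹ • ∑ l, (s ^ d l) • S l) - ((t ^ d π)⁻¹ • ∑ l, (t ^ d l) • S l)).PosSemidef := by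
  have hsymm : (((s ^ d π)⁻¹ • ∑ l, (s ^ d l) • S l) - ((t ^ d π)⁻¹ • ∑ l, (t ^ d l) • S l)).IsHermitian := by
    have h0 : (((s ^ d π)⁻¹ • ∑ l, (s ^ d l) • S l) - ((t ^ d π)⁻¹ • ∑ l, (t ^ d l) • S l)).IsSymm := by
      unfold Matrix.IsSymm
      rw [Matrix.transpose_sub, (LoewnerSector.smul_family_isSymm d S hS _ s).eq,
        (LoewnerSector.smul_family_isSymm d S hS _ t).eq]
    exact Matrix.isHermitian_iff_isSymm.2 h0
  refine Matrix.PosSemidef.of_dotProduct_mulVec_nonneg hsymm fun v => ?_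
  rw [star_trivial, DominantMiddle.quadForm_diff]
  have hq : ∀ l, d l ≠ d π → 0 ≤ v ⬝ᵥ (S l *ᵥ v) := fun l hl => by
    simpa only [star_trivial] using (hsign l hl).dotProduct_mulVec_nonneg v
  have hd0 := hdom.dotProduct_mulVec_nonneg v
  rw [star_trivial, Matrix.sub_mulVec, dotProduct_sub, DominantMiddle.quadForm_finsum,
    DominantMiddle.quadForm_finsum, sub_nonneg] at hd0
  exact PivotValley.scalar_anti_left d π (fun l => v ⬝ᵥ (S l *ᵥ v)) hq x₁ hx₁ hd0 hs hst htx

/-- **Right flank.**  If at `x₂ > 0` the above-pivot letters dominate the below-pivot ones,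
`∑_{d_l>d_π}(d_l−d_π)·x₂^{d_l}·S_l ⪰ ∑_{d_l<d_π}(d_π−d_l)·x₂^{d_l}·S_l`, then `u ↦ F(u)/u^{d_π}` is Loewner
non-decreasing on `[x₂, ∞)`. [folklore] -/
theorem flank_mono_right {ι : Type} [Fintype ι] [DecidableEq ι] {K : ℕ} (d : Fin K → ℕ)
    (S : Fin K → Matrix ι ι ℝ) (hS : ∀ l, (S l).IsSymm) (π : Fin K) (hsign : ∀ l, d l ≠ d π → (S l).PosSemidef)
    (x₂ : ℝ) (hx₂ : 0 < x₂)
    (hdom : (∑ l ∈ univ.filter (fun l => d π < d l), (((d l - d π : ℕ) : ℝ) * x₂ ^ d l) • S l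
      - ∑ l ∈ univ.filter (fun l => d l < d π), (((d π - d l : ℕ) : ℝ) * x₂ ^ d l) • S l).PosSemidef)
    (s t : ℝ) (hxs : x₂ ≤ s) (hst : s ≤ t) :
    (((t ^ d π)⁻¹ • ∑ l, (t ^ d l) • S l) - ((s ^ d π)⁻¹ • ∑ l, (s ^ d l) • S l)).PosSemidef := by
  have hsymm : (((t ^ d π)⁻¹ • ∑ l, (t ^ d l) • S l) - ((s ^ d π)⁻¹ • ∑ l, (s ^ d l) • S l)).IsHermitian := by
    have h0 : (((t ^ d π)⁻¹ • ∑ l, (t ^ d l) • S l) - ((s ^ d π)⁻¹ • ∑ l, (s ^ d l) • S l)).IsSymm := by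
      unfold Matrix.IsSymm
      rw [Matrix.transpose_sub, (LoewnerSector.smul_family_isSymm d S hS _ t).eq,
        (LoewnerSector.smul_family_isSymm d S hS _ s).eq]
    exact Matrix.isHermitian_iff_isSymm.2 h0
  refine Matrix.PosSemidef.of_dotProduct_mulVec_nonneg hsymm fun v => ?_
  rw [star_trivial, DominantMiddle.quadForm_diff]
  have hq : ∀ l, d l ≠ d π → 0 ≤ v ⬝ᵥ (S l *ᵥ v) := fun l hl => by
    simpa only [star_trivial] using (hsign l hl).dotProduct_mulVec_nonneg v
  have hd0 := hdom.dotProduct_mulVec_nonneg v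
  rw [star_trivial, Matrix.sub_mulVec, dotProduct_sub, DominantMiddle.quadForm_finsum,
    DominantMiddle.quadForm_finsum, sub_nonneg] at hd0
  exact PivotValley.scalar_mono_right d π (fun l => v ⬝ᵥ (S l *ᵥ v)) hq x₂ hx₂ hd0 hxs hst

/-- **PIVOT-VALLEY LAW.**  `F = ∑ₗ X^{dₗ} Sₗ` with a pivot index `π` (letter `S_π` ARBITRARY symmetric) and every
letter off the pivot exponent positive semidefinite; scales `0 < x₁ ≤ x₂` with the left-flank dominance at `x₁` and
the right-flank dominance at `x₂`.  If the valley `[x₁, x₂)` carries no zero of `det F`, then `det F` has at most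
`2 · card ι` distinct positive zeros (`card ι` on each flank). [folklore] -/
theorem pivotValley_posRoots_le (ι : Type) [Fintype ι] [DecidableEq ι] {K : ℕ} (d : Fin K → ℕ)
    (S : Fin K → Matrix ι ι ℝ) (hS : ∀ l, (S l).IsSymm) (π : Fin K) (hsign : ∀ l, d l ≠ d π → (S l).PosSemidef)
    (x₁ x₂ : ℝ) (hx₁ : 0 < x₁) (hx₁₂ : x₁ ≤ x₂)
    (hdom₁ : (∑ l ∈ univ.filter (fun l => d l < d π), (((d π - d l : ℕ) : ℝ) * x₁ ^ d l) • S l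
      - ∑ l ∈ univ.filter (fun l => d π < d l), (((d l - d π : ℕ) : ℝ) * x₁ ^ d l) • S l).PosSemidef)
    (hdom₂ : (∑ l ∈ univ.filter (fun l => d π < d l), (((d l - d π : ℕ) : ℝ) * x₂ ^ d l) • S l
      - ∑ l ∈ univ.filter (fun l => d l < d π), (((d π - d l : ℕ) : ℝ) * x₂ ^ d l) • S l).PosSemidef)
    (hmid : ∀ x, x₁ ≤ x → x < x₂ →
      (Matrix.det (∑ l, ((Polynomial.X : Polynomial ℝ) ^ d l) • (S l).map Polynomial.C)).eval x ≠ 0) :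
    ((Matrix.det (∑ l, ((Polynomial.X : Polynomial ℝ) ^ d l) • (S l).map Polynomial.C)
        ).roots.toFinset.filter (fun t => 0 < t)).card ≤ 2 * Fintype.card ι := by
  classical
  set P := Matrix.det (∑ l, ((Polynomial.X : Polynomial ℝ) ^ d l) • (S l).map Polynomial.C) with hP
  have h1 : (P.roots.toFinset.filter (fun t => 0 < t ∧ t < x₁)).card ≤ Fintype.card ι :=
    posRoots_Ioo_le_of_anti ι d S hS x₁ hx₁ (fun u => u ^ d π) (fun u hu _ => pow_pos hu _)
      (fun s t hs hst htx => flank_anti_left d S hS π hsign x₁ hx₁ hdom₁ s t hs hst htx)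
  have h2 : (P.roots.toFinset.filter (fun t => x₂ ≤ t)).card ≤ Fintype.card ι :=
    posRoots_Ici_le_of_mono ι d S hS x₂ (hx₁.trans_le hx₁₂) (fun u => u ^ d π)
      (fun u hu => pow_pos ((hx₁.trans_le hx₁₂).trans_le hu) _)
      (fun s t hs hst => flank_mono_right d S hS π hsign x₂ (hx₁.trans_le hx₁₂) hdom₂ s t hs hst)
  have hsub : P.roots.toFinset.filter (fun t => 0 < t)
      ⊆ P.roots.toFinset.filter (fun t => 0 < t ∧ t < x₁) ∪ P.roots.toFinset.filter (fun t => x₂ ≤ t) := by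
    intro t ht
    rw [Finset.mem_filter] at ht
    rw [Finset.mem_union, Finset.mem_filter, Finset.mem_filter]
    by_cases htx₁ : t < x₁
    · exact Or.inl ⟨ht.1, ht.2, htx₁⟩
    · by_cases htx₂ : x₂ ≤ t
      · exact Or.inr ⟨ht.1, htx₂⟩
      · exfalso
        push Not at htx₁ htx₂
        have hroot : P.IsRoot t := by
          have hmem := Multiset.mem_toFinset.1 ht.1
          exact (Polynomial.mem_roots (Polynomial.ne_zero_of_mem_roots hmem)).1 hmem
        exact hmid t htx₁ htx₂ hroot
  calc (P.roots.toFinset.filter (fun t => 0 < t)).card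
      ≤ (P.roots.toFinset.filter (fun t => 0 < t ∧ t < x₁) ∪ P.roots.toFinset.filter (fun t => x₂ ≤ t)).card :=
        Finset.card_le_card hsub
    _ ≤ (P.roots.toFinset.filter (fun t => 0 < t ∧ t < x₁)).card
        + (P.roots.toFinset.filter (fun t => x₂ ≤ t)).card := Finset.card_union_le _ _
    _ ≤ Fintype.card ι + Fintype.card ι := Nat.add_le_add h1 h2
    _ = 2 * Fintype.card ι := by ring

/-- **Valley certificate.**  With every non-pivot LETTER positive semidefinite and `S_π + J₋ ⪰ 0` for some `J₋ ⪰ 0`: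
if `∑_{l ≠ π} x₁^{d_l}·S_l − x₂^{d_π}·J₋ ≻ 0`, then `F(x) ≻ 0` — hence `det F(x) ≠ 0` — for every `x ∈ [x₁, x₂]`
(`0 < x₁`). [folklore] -/
theorem valley_det_ne_zero {ι : Type} [Fintype ι] [DecidableEq ι] {K : ℕ} (d : Fin K → ℕ)
    (S : Fin K → Matrix ι ι ℝ) (π : Fin K) (hsign : ∀ l, l ≠ π → (S l).PosSemidef)
    (Jm : Matrix ι ι ℝ) (hJm : Jm.PosSemidef) (hJ : (S π + Jm).PosSemidef)
    (x₁ x₂ : ℝ) (hx₁ : 0 < x₁)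
    (hcert : (∑ l ∈ univ.erase π, (x₁ ^ d l) • S l - (x₂ ^ d π) • Jm).PosDef)
    (x : ℝ) (hx₁x : x₁ ≤ x) (hxx₂ : x ≤ x₂) :
    (Matrix.det (∑ l, ((Polynomial.X : Polynomial ℝ) ^ d l) • (S l).map Polynomial.C)).eval x ≠ 0 := by
  classical
  rw [ChainSector.eval_det_pencil d S x]
  have hx : 0 < x := hx₁.trans_le hx₁x
  -- `F(x) = M₀ + R` with `M₀ ≻ 0` the certificate and `R ⪰ 0`
  have hdecomp : ∑ l, (x ^ d l) • S l
      = (∑ l ∈ univ.erase π, (x₁ ^ d l) • S l - (x₂ ^ d π) • Jm)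
        + ((x ^ d π) • (S π + Jm) + (x₂ ^ d π - x ^ d π) • Jm
          + ∑ l ∈ univ.erase π, (x ^ d l - x₁ ^ d l) • S l) := by
    rw [← Finset.add_sum_erase _ _ (Finset.mem_univ π), smul_add, sub_smul]
    have e : ∑ l ∈ univ.erase π, (x ^ d l - x₁ ^ d l) • S l
        = ∑ l ∈ univ.erase π, (x ^ d l) • S l - ∑ l ∈ univ.erase π, (x₁ ^ d l) • S l := by
      rw [← Finset.sum_sub_distrib]
      exact Finset.sum_congr rfl fun l _ => sub_smul _ _ _
    rw [e]
    abel
  have hR : ((x ^ d π) • (S π + Jm) + (x₂ ^ d π - x ^ d π) • Jm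
      + ∑ l ∈ univ.erase π, (x ^ d l - x₁ ^ d l) • S l).PosSemidef := by
    refine ((hJ.smul (pow_nonneg hx.le _)).add (hJm.smul ?_)).add ?_
    · exact sub_nonneg.2 (pow_le_pow_left₀ hx.le hxx₂ _)
    · exact Finset.sum_induction _ (fun M : Matrix ι ι ℝ => M.PosSemidef) (fun a b ha hb => ha.add hb)
        Matrix.PosSemidef.zero
        (fun l hl => (hsign l (Finset.ne_of_mem_erase hl)).smul
          (sub_nonneg.2 (pow_le_pow_left₀ hx₁.le hx₁x _)))
  have hF : (∑ l, (x ^ d l) • S l).PosDef := by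
    rw [hdecomp]
    exact Matrix.PosDef.add_posSemidef hcert hR
  exact hF.det_pos.ne'

/-- **PIVOT-VALLEY LAW with certificate.**  `F = X^{d_π} J + ∑_{l≠π} X^{d_l} P_l` with `J = S_π` ANY symmetric
letter and all other letters `⪰ 0` (any gaps, letters on both sides); scales `0 < x₁ ≤ x₂` with the left-flank
dominance at `x₁`, the right-flank dominance at `x₂`, and the valley certificate `∑_{l≠π} x₁^{d_l}·S_l ≻ x₂^{d_π}·J₋`
for some `J₋ ⪰ 0` with `J + J₋ ⪰ 0`.  Then `det F` has at most `2 · card ι` distinct positive zeros — the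
indefinite-pivot counterpart of `dominantMiddle`. [folklore] -/
theorem pivotValley_posRoots_le_of_certificate (ι : Type) [Fintype ι] [DecidableEq ι] {K : ℕ} (d : Fin K → ℕ)
    (S : Fin K → Matrix ι ι ℝ) (hS : ∀ l, (S l).IsSymm) (π : Fin K) (hsign : ∀ l, l ≠ π → (S l).PosSemidef)
    (Jm : Matrix ι ι ℝ) (hJm : Jm.PosSemidef) (hJ : (S π + Jm).PosSemidef)
    (x₁ x₂ : ℝ) (hx₁ : 0 < x₁) (hx₁₂ : x₁ ≤ x₂)
    (hdom₁ : (∑ l ∈ univ.filter (fun l => d l < d π), (((d π - d l : ℕ) : ℝ) * x₁ ^ d l) • S l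
      - ∑ l ∈ univ.filter (fun l => d π < d l), (((d l - d π : ℕ) : ℝ) * x₁ ^ d l) • S l).PosSemidef)
    (hdom₂ : (∑ l ∈ univ.filter (fun l => d π < d l), (((d l - d π : ℕ) : ℝ) * x₂ ^ d l) • S l
      - ∑ l ∈ univ.filter (fun l => d l < d π), (((d π - d l : ℕ) : ℝ) * x₂ ^ d l) • S l).PosSemidef)
    (hcert : (∑ l ∈ univ.erase π, (x₁ ^ d l) • S l - (x₂ ^ d π) • Jm).PosDef) :
    ((Matrix.det (∑ l, ((Polynomial.X : Polynomial ℝ) ^ d l) • (S l).map Polynomial.C)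
        ).roots.toFinset.filter (fun t => 0 < t)).card ≤ 2 * Fintype.card ι := by
  have hsign' : ∀ l, d l ≠ d π → (S l).PosSemidef := fun l hl => hsign l (fun h => hl (by rw [h]))
  exact pivotValley_posRoots_le ι d S hS π hsign' x₁ x₂ hx₁ hx₁₂ hdom₁ hdom₂
    (fun x hx₁x hxx₂ => valley_det_ne_zero d S π hsign Jm hJm hJ x₁ x₂ hx₁ hcert x hx₁x hxx₂.le)

end Summit.ValiantsHypothesis.ValiantsHypothesis.Theorems.LacunarySymmetroidMatrixDescartes
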